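import Summits.QuantumFields.YangMills.Theorems.LuscherReductionTwistedTraceScalingBTProfileAssembly
import Summits.QuantumFields.YangMills.Theorems.LuscherReductionTwistedTraceScalingBTProfileRates
import Summits.QuantumFields.YangMills.Theorems.LuscherReductionTwistedTraceScalingBTProfileBudget
import HarnessLib

/-!
# ★★★ (B-T) FOR EVERY ADMISSIBLE FIBRE PROFILE OF RADIUS `≤ β^{-1/2}log β`, and the record analytic input from (B-ST) + (B-OD) for such a profile
# (lane A of S-BASE, crux `TwistedTraceScaling` stmt-QuantumFields-20203, C4-CORE, the (B-T) pen; design note `pub/ym-fleet/ym-luscher-20007-p1/COARSE-DESIGN.md` §26)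

Schedule B: fibre radius `r` any function with `0 < r β ≤ min(1/40, β^{-1/2}ℓ)`, near/far threshold `α = β^{-1/2}ℓ²`, core jump radius `R₁ = 5α`, `ℓ = btLog β`.
* `eventually_small_B` — the thirteen smallness conjuncts on schedule B;
* ★★★ `profileB_hT` — **(B-T) for EVERY profile family** `Ω` (measurable, `0 ≤ Ω ≤ 1`, colour blind, supported in fibre radius `r β`, `γ > 0`), `0 < s ≤ 1/4`:
  the `hT` field of `RecordAnalyticInput` with `σ = C_Ω/Z/γ`, `C_Ω β = btC L β (Ω β) (btEps β) R₁(β)`, rate `κ_B = 2β^{-2s}ℓ⁹`;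
* ★★★ `recordAnalyticInput_of_profile` — (B-ST) + (B-OD) for such an `Ω` (and `∫Ω dπ > 0`) ⇒ `Nonempty (RecordAnalyticInput L s M)` (`1/6 < s ≤ 1/4`);
* ★★★ `recordAnalyticInput_of_frozenProfile` — the same for `Ω = frozenProfile L q r_B`, `r_B = min(1/40, β^{-1/2}ℓ)`, ANY colour-blind measurable stiff factor `q ≥ 0`
  — in particular the truncated frozen stiff Gaussian that (B-ST)/(B-OD) need (COARSE-DESIGN §26: the flat profile of record cannot serve them);
* ★★ `innerNoIntruderOneOrbitAt_of_frozenProfile` — hence C4-CORE(s) `InnerNoIntruderOneOrbitAt L β^{-s}` (`1/6 < s < 1/5`) from (B-ST)(M) + (B-OD)(M), `M ≥ M₀`.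
HONEST FRAMING: a stub of a child of the CONDITIONAL reduction route R2b1; C4-CORE OPEN ((B-ST), (B-OD)); not infinite volume, not a gap, not Clay.
-/

set_option autoImplicit false

noncomputable section

open MeasureTheory Filter Topology Real Asymptotics
open scoped BigOperators
open Literature.MathematicalPhysics.QuantumFieldTheory
open Literature.MathematicalPhysics.QuantumLattice

namespace Summit.QuantumFields.YangMills.Theorems.FemtoTransferGap.TwoLattice.ConstTube

open Summit.QuantumFields.YangMills.Theorems.FemtoTransferGap
open Summit.QuantumFields.YangMills.Theorems.FemtoTransferGap.TwoLattice
open Summit.QuantumFields.YangMills.Theorems.FemtoTransferGap.TwoLattice.Avg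
open Summit.QuantumFields.YangMills.Theorems.FemtoTransferGap.TwoLattice.Stiff (LinkSpace)
open Summit.QuantumFields.YangMills.Theorems.FemtoTransferGap.TwoLattice.Cov

variable {L : ℕ} [NeZero L]

/-! ## §1 The smallness conjuncts on schedule B -/

/-- **All thirteen smallness conjuncts on schedule B**, eventually (`0 < s < 1/2`, any radius `0 ≤ r ≤ β^{-1/2}ℓ`). [folklore] -/
theorem eventually_small_B {s : ℝ} (hs : 0 < s) (hs2 : s < 1 / 2) {r : ℝ → ℝ} (hr : ∀ β, 0 ≤ r β ∧ r β ≤ powScale (1 / 2) β * btLog β) :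
    ∀ᶠ β : ℝ in atTop, 0 ≤ β ∧ recordDelta1 L s β ≤ 1 / 2 ∧ powScale (1 / 2) β * btLog β ^ 2 ≤ 1 ∧
      r β ≤ 9 * L * (5 * (powScale (1 / 2) β * btLog β ^ 2)) + btEps β ∧ 9 * L * (5 * (powScale (1 / 2) β * btLog β ^ 2)) + btEps β ≤ 1 / 30 ∧
      (L : ℝ) ^ 3 * (12 * recordDelta1 L s β ^ 4) < 2 ∧
      coreEps1 L β (recordDelta1 L s β) (9 * L * (5 * (powScale (1 / 2) β * btLog β ^ 2)) + btEps β) (r β) +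
          coreEps2 L β (recordDelta1 L s β) (9 * L * (5 * (powScale (1 / 2) β * btLog β ^ 2)) + btEps β) (r β)
            ((L : ℝ) ^ 3 * (12 * recordDelta1 L s β ^ 4)) ≤ 1 ∧
      18 * L * (Real.sqrt 2 * r β + recordDelta1 L s β) ≤ 1 / 2 ∧
      0 ≤ 5 * (powScale (1 / 2) β * btLog β ^ 2) / 2 - 2 * (Real.sqrt 2 * r β + recordDelta1 L s β) * btEps β -
          (2 * Real.sqrt 2 * r β + powScale (1 / 2) β * btLog β ^ 2) ∧
      0 ≤ 1 / (3 * L) - 4 * (Real.sqrt 2 * r β + recordDelta1 L s β) - (2 * Real.sqrt 2 * r β + powScale (1 / 2) β * btLog β ^ 2) ∧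
      3 * L * (13 * recordDelta1 L s β) < 1 ∧
      0 ≤ 13 * recordDelta1 L s β - 4 * (Real.sqrt 2 * r β + recordDelta1 L s β) - (2 * Real.sqrt 2 * r β + 2 * recordDelta1 L s β) ∧
      2 * btEps β * Fintype.card (Site 3 L) * recordDelta1 L s β + 2 * r β ^ 2 +
          2 * Real.sqrt 2 * Fintype.card (Site 3 L) * (9 * L * (13 * recordDelta1 L s β) + btEps β) * r β ≤
        Fintype.card (Site 3 L) * (1 - 3 * L * (13 * recordDelta1 L s β)) * (powScale (1 / 2) β * btLog β ^ 2) := by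
  have hL1 : (1 : ℝ) ≤ L := by exact_mod_cast NeZero.one_le
  have hL0 : (0 : ℝ) < L := by linarith
  have hN : (0 : ℝ) < Fintype.card (Site 3 L) := by exact_mod_cast Fintype.card_pos
  have hN1 : (1 : ℝ) ≤ Fintype.card (Site 3 L) := by exact_mod_cast Fintype.card_pos
  have hs2' : (0 : ℝ) < 1 / 2 - s := by linarith
  have hc : (0 : ℝ) < 1 / (60 * L) := by positivity
  filter_upwards [eventually_schedule_facts (L := L) hs hs2, eventually_small_elementary (L := L) hs hs2, eventually_scheduleB_facts (L := L) hs hs2 hr,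
    eventually_coreEps_sum_le_one_B (L := L) hs hs2 hr, eventually_ge_atTop (Real.exp 14),
    (tendsto_powScale_mul_btLog_pow (show (0 : ℝ) < 1 / 2 by norm_num) 2).eventually (eventually_le_nhds (show (0 : ℝ) < 1 / (1380 * L) by positivity)),
    (tendsto_powScale_mul_btLog_pow (show (0 : ℝ) < 1 / 2 by norm_num) 1).eventually (eventually_le_nhds hc),
    (tendsto_powScale_mul_btLog_pow hs2' 1).eventually (eventually_le_nhds (show (0 : ℝ) < 14 / (9 * Fintype.card (Site 3 L)) by positivity))]
    with β hf hel hfB hε hβ14 hxl2 hxl1 hsmall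
  obtain ⟨hβ1, hℓeq, -, -, hεx, -, -, -, hδs, hεs, hδhalf⟩ := hf
  obtain ⟨-, -, -, -, -, hσ2, -, -, -, hP, -, -⟩ := hel
  obtain ⟨-, -, -, -, -, -, -, -, -, -, -, hTx, -, -, -, -, -, -, hα1⟩ := hfB
  rw [pow_one] at hxl1 hsmall
  have hℓ14 : 14 ≤ Real.log β := by rw [← Real.log_exp 14]; exact Real.log_le_log (Real.exp_pos _) hβ14
  rw [← hℓeq] at hℓ14
  have hr0 := (hr β).1
  have hrx := (hr β).2
  set x := powScale (1 / 2) β with hxdef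
  set δ := recordDelta1 L s β with hδdef
  set ℓ := btLog β with hℓdef
  set N := (Fintype.card (Site 3 L) : ℝ) with hNdef
  have hβ0 : 0 < β := by linarith
  have hx0 : 0 < x := powScale_pos _ _
  have hx1 : x ≤ 1 := powScale_le_one (by norm_num) β
  have hℓ1 : 1 ≤ ℓ := one_le_btLog β
  have hℓ0 : 0 ≤ ℓ := by linarith
  have hδ0 : 0 ≤ δ := by rw [hδdef]; unfold recordDelta1; exact div_nonneg (mul_nonneg (by norm_num) (powScale_pos _ _).le) hN.le
  have hε0 : 0 ≤ btEps β := (btEps_pos_le β).1.le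
  have h2 : Real.sqrt 2 ≤ 3 / 2 := by rw [Real.sqrt_le_left (by norm_num)]; norm_num
  have hs20 : 0 ≤ Real.sqrt 2 := Real.sqrt_nonneg _
  have hxl0 : 0 ≤ x * ℓ := by positivity
  have hxl20 : 0 ≤ x * ℓ ^ 2 := by positivity
  have e2r : Real.sqrt 2 * r β ≤ 3 / 2 * (x * ℓ) := mul_le_mul h2 hrx hr0 (by norm_num)
  have h60 : (1 : ℝ) / (60 * L) ≤ 1 := by rw [div_le_one (by positivity)]; linarith
  have hxl1' : x * ℓ ≤ 1 := hxl1.trans h60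
  have hLδ : (L : ℝ) * δ < 1 / 4000 := by
    have := mul_lt_mul_of_pos_left hδs hL0; rwa [show (L : ℝ) * (1 / (4000 * L)) = 1 / 4000 by field_simp] at this
  have hδ4000 : δ < 1 / 4000 := lt_of_le_of_lt (le_mul_of_one_le_left hδ0 hL1) hLδ
  -- `9xℓ ≤ δ`
  have hx9 : 9 * (x * ℓ) ≤ δ := by
    have e : x * ℓ = powScale (1 / 2 - s) β * ℓ * powScale s β := by
      rw [hxdef, powScale_eq hβ1, powScale_eq hβ1, powScale_eq hβ1]
      rw [show -(1 / 2 : ℝ) = -(1 / 2 - s) + -s by ring, Real.rpow_add hβ0]; ring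
    have hδeq : δ = 14 * powScale s β / N := rfl
    rw [e, hδeq, le_div_iff₀ hN]
    have hp := powScale_pos s β
    have hsmall' : powScale (1 / 2 - s) β * ℓ * (9 * N) ≤ 14 := by rwa [le_div_iff₀ (by positivity)] at hsmall
    calc 9 * (powScale (1 / 2 - s) β * ℓ * powScale s β) * N = (powScale (1 / 2 - s) β * ℓ * (9 * N)) * powScale s β := by ring
      _ ≤ 14 * powScale s β := mul_le_mul_of_nonneg_right hsmall' hp.le
  refine ⟨hβ0.le, hδhalf, hα1, ?_, ?_, hσ2, hε, ?_, ?_, ?_, hP, ?_, ?_⟩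
  · -- `r ≤ T`
    have h1 : x * ℓ ≤ x * ℓ ^ 2 := by rw [sq, ← mul_assoc]; exact le_mul_of_one_le_right hxl0 hℓ1
    have h45 : (1 : ℝ) ≤ 9 * L * 5 := by linarith
    have h3 : x * ℓ ^ 2 ≤ 9 * L * (5 * (x * ℓ ^ 2)) := by
      calc x * ℓ ^ 2 = 1 * (x * ℓ ^ 2) := by ring
        _ ≤ (9 * L * 5) * (x * ℓ ^ 2) := mul_le_mul_of_nonneg_right h45 hxl20
        _ = 9 * L * (5 * (x * ℓ ^ 2)) := by ring
    linarith
  · -- `T ≤ 1/30`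
    have : 46 * (L : ℝ) * x * ℓ ^ 2 ≤ 46 * L * (1 / (1380 * L)) := by
      have := mul_le_mul_of_nonneg_left hxl2 (by positivity : (0 : ℝ) ≤ 46 * L); linarith
    rw [show 46 * (L : ℝ) * (1 / (1380 * L)) = 1 / 30 by field_simp; norm_num] at this
    exact hTx.trans this
  · -- `18L(√2 r + δ) ≤ 1/2`
    have a1 : Real.sqrt 2 * r β ≤ 3 / 2 * (1 / (60 * L)) := e2r.trans (by linarith)
    have e1 : 18 * (L : ℝ) * (Real.sqrt 2 * r β) ≤ 18 * L * (3 / 2 * (1 / (60 * L))) := mul_le_mul_of_nonneg_left a1 (by positivity)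
    rw [show 18 * (L : ℝ) * (3 / 2 * (1 / (60 * L))) = 9 / 20 by field_simp; norm_num] at e1
    have e2 : 18 * (L : ℝ) * (Real.sqrt 2 * r β + δ) = 18 * L * (Real.sqrt 2 * r β) + 18 * (L * δ) := by ring
    rw [e2]; linarith
  · -- near margin
    have hεxl : btEps β ≤ x * ℓ := hεx.trans (le_mul_of_one_le_right hx0.le hℓ1)
    have h4 : 2 * (Real.sqrt 2 * r β + δ) * btEps β ≤ 2 * (3 / 2 * (x * ℓ) + 1 / 2) * (x * ℓ) :=
      mul_le_mul (by linarith) hεxl hε0 (by positivity)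
    have h5 : (x * ℓ) * (x * ℓ) ≤ 1 * (x * ℓ) := mul_le_mul_of_nonneg_right hxl1' hxl0
    have h6 : 2 * (3 / 2 * (x * ℓ) + 1 / 2) * (x * ℓ) = 3 * ((x * ℓ) * (x * ℓ)) + x * ℓ := by ring
    have e3 : x * ℓ * 14 ≤ x * ℓ * ℓ := mul_le_mul_of_nonneg_left hℓ14 hxl0
    have e4 : x * ℓ ^ 2 = x * ℓ * ℓ := by ring
    linarith
  · -- very-rough margin
    have hu4000 : (1 : ℝ) / (4000 * L) = 1 / (3 * L) * (3 / 4000) := by ring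
    have hu60 : (1 : ℝ) / (60 * L) = 1 / (3 * L) / 20 := by ring
    have hu1380 : (1 : ℝ) / (1380 * L) = 1 / (3 * L) / 460 := by ring
    have hu0 : (0 : ℝ) < 1 / (3 * L) := by positivity
    rw [hu4000] at hδs
    rw [hu60] at hxl1
    rw [hu1380] at hxl2
    linarith
  · -- rough margin `7δ − 6√2 r ≥ 0`
    linarith
  · -- far junk below the far signal
    have hNx : 0 ≤ N * x := by positivity
    have h39 : 1 / 2 ≤ 1 - 3 * (L : ℝ) * (13 * δ) := by linarith
    have hsig : N * (1 / 2) * (x * ℓ ^ 2) ≤ N * (1 - 3 * L * (13 * δ)) * (x * ℓ ^ 2) := by gcongr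
    have j1 : 2 * btEps β * N * δ ≤ N * x := by
      have h := mul_le_mul hεx hδhalf hδ0 hx0.le
      have := mul_le_mul_of_nonneg_left h (by positivity : (0 : ℝ) ≤ 2 * N)
      have e : 2 * N * (btEps β * δ) = 2 * btEps β * N * δ := by ring
      have e' : 2 * N * (x * (1 / 2)) = N * x := by ring
      linarith
    have j2 : 2 * r β ^ 2 ≤ 2 * (N * x) := by
      have hq := pow_le_pow_left₀ hr0 hrx 2
      have h' : x ≤ N * x := le_mul_of_one_le_left hx0.le hN1
      have h6 : (x * ℓ ^ 2) * x ≤ 1 * x := mul_le_mul_of_nonneg_right hα1 hx0.le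
      have h7 : r β ^ 2 ≤ N * x :=
        calc r β ^ 2 ≤ (x * ℓ) ^ 2 := hq
          _ = (x * ℓ ^ 2) * x := by ring
          _ ≤ 1 * x := h6
          _ = x := one_mul x
          _ ≤ N * x := h'
      linarith only [h7]
    have j3 : 2 * Real.sqrt 2 * N * (9 * L * (13 * δ) + btEps β) * r β ≤ 3 * (31 / 1000) * (N * (x * ℓ)) := by
      have hin : 9 * (L : ℝ) * (13 * δ) + btEps β ≤ 31 / 1000 := by linarith
      have hin0 : 0 ≤ 9 * (L : ℝ) * (13 * δ) + btEps β := by positivity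
      have h22 : 2 * Real.sqrt 2 ≤ 3 := by linarith
      calc 2 * Real.sqrt 2 * N * (9 * L * (13 * δ) + btEps β) * r β = 2 * Real.sqrt 2 * (9 * L * (13 * δ) + btEps β) * (N * r β) := by ring
        _ ≤ 3 * (31 / 1000) * (N * (x * ℓ)) :=
            mul_le_mul (mul_le_mul h22 hin hin0 (by norm_num)) (mul_le_mul_of_nonneg_left hrx hN.le) (by positivity) (by norm_num)
    have hℓN : N * x * 14 ≤ N * x * ℓ := mul_le_mul_of_nonneg_left hℓ14 hNx
    have hℓN2 : N * (x * ℓ) * 14 ≤ N * (x * ℓ) * ℓ := mul_le_mul_of_nonneg_left hℓ14 (by positivity)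
    linarith only [hsig, j1, j2, j3, hℓN, hℓN2, hNx]

/-! ## §2 ★★★ (B-T) for every admissible profile on schedule B -/

/-- ★★★ **(B-T) FOR EVERY ADMISSIBLE FIBRE PROFILE** (`0 < s ≤ 1/4`; radius `0 < r β ≤ min(1/40, β^{-1/2}ℓ)`): eventually, for gauge-invariant bounded measurable `φ` supported
in `{orbitDist < δ₁(β)}`, `|T_β(boFun φ Ω_β) − σγ·Q(φ)| ≤ κ_B(β)·σγ·(Q(φ) + λ₀‖φ‖²)`, `σ = C_Ω/Z/γ`, `κ_B = 2β^{-2s}ℓ⁹`. [cite: Luscher1983, §3] -/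
theorem profileB_hT {s : ℝ} (hs : 0 < s) (hs4 : s ≤ 1 / 4) {Ω : ℝ → LinkSpace L → ℝ} (hΩm : ∀ β, Measurable (Ω β)) (hΩ1 : ∀ β x, |Ω β x| ≤ 1)
    (hΩ0 : ∀ β x, 0 ≤ Ω β x) (hΩinv : ∀ β (g : SU2) (x : LinkSpace L), Ω β (adL L g x) = Ω β x) {r : ℝ → ℝ}
    (hr : ∀ β, 0 < r β ∧ r β ≤ 1 / 40 ∧ r β ≤ powScale (1 / 2) β * btLog β)
    (hΩt : ∀ β (v : Edge 3 L → Fin 3 → ℝ), Ω β (linkEmbed L v) ≠ 0 → (∀ (e : Edge 3 L) (c : Fin 3), |v e c| ≤ r β) ∧ ‖linkEmbed L v‖ ≤ r β)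
    (hγ : ∀ β, 0 < recordGamma L Ω β) :
    ∀ᶠ β : ℝ in atTop, ∀ φ : GaugeConfig 3 1 SU2 → ℝ, Measurable φ → (∃ C : ℝ, ∀ u, |φ u| ≤ C) →
      (∀ (g : Site 3 1 → SU2) (u : GaugeConfig 3 1 SU2), φ (gaugeTransform g u) = φ u) → (∀ u, φ u ≠ 0 → orbitDist u < recordDelta1 L s β) →
      |tubeForm β (boFun L φ (Ω β)) -
          (btC L β (Ω β) (btEps β) (5 * (powScale (1 / 2) β * btLog β ^ 2)) / fpZ (btEps β) / recordGamma L Ω β) * recordGamma L Ω β *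
            qform su2Rep ((L : ℝ) ^ 3 * β) φ φ| ≤
        2 * (powScale (2 * s) β * btLog β ^ 9) *
          ((btC L β (Ω β) (btEps β) (5 * (powScale (1 / 2) β * btLog β ^ 2)) / fpZ (btEps β) / recordGamma L Ω β) * recordGamma L Ω β) *
          (qform su2Rep ((L : ℝ) ^ 3 * β) φ φ + levelValue su2Rep 1 ((L : ℝ) ^ 3 * β) 0 * l2 φ φ) := by
  have hs2 : s < 1 / 2 := by linarith
  have hr' : ∀ β, 0 ≤ r β ∧ r β ≤ powScale (1 / 2) β * btLog β := fun β => ⟨(hr β).1.le, (hr β).2.2⟩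
  have hα : ∀ β : ℝ, 0 ≤ powScale (1 / 2) β * btLog β ^ 2 := fun β =>
    mul_nonneg (powScale_pos _ _).le (pow_nonneg (zero_le_one.trans (one_le_btLog β)) 2)
  exact profile_hT_of_eventually (R₁ := fun β => 5 * (powScale (1 / 2) β * btLog β ^ 2)) hs hΩm hΩ1 hΩ0 hΩinv hΩt hγ (fun β => ⟨(hr β).1, (hr β).2.1⟩) hα
    (rateB_ge (L := L) hs hs4 hr') (eventually_small_B (L := L) hs hs2 hr') (eventually_budget_B (L := L) hs hs2 hr')

/-! ## §3 ★★★ The record analytic input from (B-ST) + (B-OD), for every admissible profile -/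

/-- ★★★ **`RecordAnalyticInput L s M` FROM (B-ST) AND (B-OD) FOR AN ADMISSIBLE PROFILE** (`1/6 < s ≤ 1/4`): `Ω` measurable, `0 ≤ Ω ≤ 1`, colour blind, supported in fibre radius
`r β ≤ min(1/40, β^{-1/2}ℓ)`, `∫Ω dπ > 0`, `γ > 0`; slow factor `σ_Ω = C_Ω/Z/γ` (made positive everywhere by an `if`, harmless: the bricks are eventual), rate `κ_B = 2β^{-2s}ℓ⁹`.
[cite: Luscher1983, §3] [cite: SjostrandZworski2007, §2] -/
theorem recordAnalyticInput_of_profile {s M : ℝ} (hs6 : 1 / 6 < s) (hs4 : s ≤ 1 / 4) {Ω : ℝ → LinkSpace L → ℝ} (hΩm : ∀ β, Measurable (Ω β))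
    (hΩ1 : ∀ β x, |Ω β x| ≤ 1) (hΩ0 : ∀ β x, 0 ≤ Ω β x) (hΩinv : ∀ β (g : SU2) (x : LinkSpace L), Ω β (adL L g x) = Ω β x)
    (hΩr : ∀ β x, Ω β x ≠ 0 → ‖x‖ ≤ min (1 / 40) (powScale (1 / 2) β * btLog β))
    (hI : ∀ β, 0 < ∫ v, Ω β (linkEmbed L v) ∂orthoTransverse L) (hγ : ∀ β, 0 < recordGamma L Ω β)
    {b : ℝ → ℝ} {θ₀ : ℝ} (hb : ∀ β, 0 ≤ b β) (hb_small : ∀ a : ℝ, 0 < a → ∀ᶠ β in atTop, b β ^ 2 ≤ a * bareLambda ((L : ℝ) ^ 3 * β)) (hθ₀ : 0 < θ₀ ∧ θ₀ ≤ 1)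
    (hST : ∀ᶠ β in atTop, ∀ v : GaugeConfig 3 L SU2 → ℝ, Measurable v → (∃ C : ℝ, ∀ U, |v U| ≤ C) → (∀ U, v U ≠ 0 → recordChi L s 43 M β U ≠ 0) →
      (∀ u, fibreInner L (softWeight (recordChi L s 43 M β)) (Ω β) v u = 0) →
      tubeForm β v ≤ (1 - θ₀) * ((btC L β (Ω β) (btEps β) (5 * (powScale (1 / 2) β * btLog β ^ 2)) / fpZ (btEps β) / recordGamma L Ω β) *
        levelValue su2Rep 1 ((L : ℝ) ^ 3 * β) 0) * tubeNormSq (softWeight (recordChi L s 43 M β)) v)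
    (hOD : ∀ᶠ β in atTop, ∀ (φ : GaugeConfig 3 1 SU2 → ℝ) (v : GaugeConfig 3 L SU2 → ℝ), Measurable φ → (∃ C : ℝ, ∀ u, |φ u| ≤ C) →
      (∀ u, φ u ≠ 0 → orbitDist u < recordDelta1 L s β) → Measurable v → (∃ C : ℝ, ∀ U, |v U| ≤ C) → (∀ U, v U ≠ 0 → recordChi L s 43 M β U ≠ 0) →
      (∀ u, fibreInner L (softWeight (recordChi L s 43 M β)) (Ω β) v u = 0) →
      |tubeCross β (boFun L φ (Ω β)) v| ≤ b β * ((btC L β (Ω β) (btEps β) (5 * (powScale (1 / 2) β * btLog β ^ 2)) / fpZ (btEps β) / recordGamma L Ω β) *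
          levelValue su2Rep 1 ((L : ℝ) ^ 3 * β) 0) *
          Real.sqrt (tubeNormSq (softWeight (recordChi L s 43 M β)) (boFun L φ (Ω β))) * Real.sqrt (tubeNormSq (softWeight (recordChi L s 43 M β)) v) ∧
      |tubeCross β v (boFun L φ (Ω β))| ≤ b β * ((btC L β (Ω β) (btEps β) (5 * (powScale (1 / 2) β * btLog β ^ 2)) / fpZ (btEps β) / recordGamma L Ω β) *
          levelValue su2Rep 1 ((L : ℝ) ^ 3 * β) 0) *
          Real.sqrt (tubeNormSq (softWeight (recordChi L s 43 M β)) (boFun L φ (Ω β))) * Real.sqrt (tubeNormSq (softWeight (recordChi L s 43 M β)) v)) :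
    Nonempty (RecordAnalyticInput L s M) := by
  have hs0 : 0 < s := by linarith
  have hs2 : s < 1 / 2 := by linarith
  set r : ℝ → ℝ := fun β => min (1 / 40) (powScale (1 / 2) β * btLog β) with hrdef
  have hr : ∀ β, 0 < r β ∧ r β ≤ 1 / 40 ∧ r β ≤ powScale (1 / 2) β * btLog β := fun β =>
    ⟨lt_min (by norm_num) (mul_pos (powScale_pos _ _) (lt_of_lt_of_le one_pos (one_le_btLog β))), min_le_left _ _, min_le_right _ _⟩
  have hr' : ∀ β, 0 ≤ r β ∧ r β ≤ powScale (1 / 2) β * btLog β := fun β => ⟨(hr β).1.le, (hr β).2.2⟩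
  have hΩt : ∀ β (v : Edge 3 L → Fin 3 → ℝ), Ω β (linkEmbed L v) ≠ 0 → (∀ (e : Edge 3 L) (c : Fin 3), |v e c| ≤ r β) ∧ ‖linkEmbed L v‖ ≤ r β := by
    intro β v hv
    have h := hΩr β _ hv
    exact ⟨fun e c => by have := abs_apply_le_norm (linkEmbed L v) e c; rw [linkEmbed_apply] at this; exact this.trans h, h⟩
  set σf : ℝ → ℝ := fun β => btC L β (Ω β) (btEps β) (5 * (powScale (1 / 2) β * btLog β ^ 2)) / fpZ (btEps β) / recordGamma L Ω β with hσfdef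
  have hσfpos : ∀ β, 0 ≤ β → 0 < σf β := fun β hβ => by
    rw [hσfdef]; dsimp only
    have hρR : 2 * (btEps β / 3) < 5 * (powScale (1 / 2) β * btLog β ^ 2) := by
      have hεx : btEps β ≤ powScale (1 / 2) β := powScale_le_powScale (by norm_num) β
      have hx0 := powScale_pos (1 / 2) β
      have h1 : powScale (1 / 2) β * 1 ≤ powScale (1 / 2) β * btLog β ^ 2 := mul_le_mul_of_nonneg_left (one_le_pow₀ (one_le_btLog β)) hx0.le
      linarith
    exact div_pos (div_pos (btC_profile_pos hβ (hΩm β) (hΩ1 β) (hΩ0 β) (by linarith [(hr β).2.1]) (hΩt β) (hI β) hρR) (fpZ_pos (btEps_pos_le β).1)) (hγ β)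
  set σ : ℝ → ℝ := fun β => if 0 < σf β then σf β else 1 with hσdef
  have hσpos : ∀ β, 0 < σ β := fun β => by
    rw [hσdef]; dsimp only
    split_ifs with h
    · exact h
    · exact one_pos
  have hσeq : ∀ᶠ β : ℝ in atTop, σ β = σf β :=
    (eventually_ge_atTop (0 : ℝ)).mono fun β hβ => by rw [hσdef]; dsimp only; rw [if_pos (hσfpos β hβ)]
  refine ⟨
    { Ω := Ω, r := r, σ := σ, κ := fun β => 2 * (powScale (2 * s) β * btLog β ^ 9), b := b, θ₀ := θ₀,
      hΩm := hΩm, hΩ1 := hΩ1, hΩinv := hΩinv, hΩr := hΩr, hr := fun β => ⟨(hr β).1.le, by linarith [(hr β).2.1]⟩,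
      hr_small := eventually_radius_small_B hs2 hr', hγ := hγ,
      hσ := hσpos, hκ0 := rateB_nonneg s, hκ_dom := rateB_dom s, hκ_small := rateB_small (L := L) hs6, hb := hb, hb_small := hb_small, hθ₀ := hθ₀,
      hT := ?_, hST := ?_, hOD := ?_ }⟩
  · filter_upwards [profileB_hT (L := L) hs0 hs4 hΩm hΩ1 hΩ0 hΩinv hr hΩt hγ, hσeq] with β h he
    rw [he]
    exact h
  · filter_upwards [hST, hσeq] with β h he
    rw [he]
    exact h
  · filter_upwards [hOD, hσeq] with β h he
    rw [he]
    exact h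

/-! ## §4 ★★★ The frozen profiles qualify -/

/-- ★★★ **`RecordAnalyticInput L s M` FROM (B-ST) AND (B-OD) FOR A FROZEN PROFILE** `Ω = frozenProfile L q r_B` with `r_B β = min(1/40, β^{-1/2}ℓ)` and ANY measurable colour-blind
stiff factor `q ≥ 0` (e.g. the frozen stiff Gaussian), `1/6 < s ≤ 1/4`. [cite: Luscher1983, §3] [cite: SjostrandZworski2007, §2] -/
theorem recordAnalyticInput_of_frozenProfile {s M : ℝ} (hs6 : 1 / 6 < s) (hs4 : s ≤ 1 / 4) {q : ℝ → LinkSpace L → ℝ} (hq : ∀ β, Measurable (q β))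
    (hq0 : ∀ β x, 0 ≤ q β x) (hqinv : ∀ β (g : SU2) (x : LinkSpace L), q β (adL L g x) = q β x)
    {b : ℝ → ℝ} {θ₀ : ℝ} (hb : ∀ β, 0 ≤ b β) (hb_small : ∀ a : ℝ, 0 < a → ∀ᶠ β in atTop, b β ^ 2 ≤ a * bareLambda ((L : ℝ) ^ 3 * β)) (hθ₀ : 0 < θ₀ ∧ θ₀ ≤ 1)
    (hST : ∀ᶠ β in atTop, ∀ v : GaugeConfig 3 L SU2 → ℝ, Measurable v → (∃ C : ℝ, ∀ U, |v U| ≤ C) → (∀ U, v U ≠ 0 → recordChi L s 43 M β U ≠ 0) →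
      (∀ u, fibreInner L (softWeight (recordChi L s 43 M β)) (frozenProfile L q (fun β => min (1 / 40) (powScale (1 / 2) β * btLog β)) β) v u = 0) →
      tubeForm β v ≤ (1 - θ₀) *
        ((btC L β (frozenProfile L q (fun β => min (1 / 40) (powScale (1 / 2) β * btLog β)) β) (btEps β) (5 * (powScale (1 / 2) β * btLog β ^ 2)) / fpZ (btEps β) /
            recordGamma L (frozenProfile L q (fun β => min (1 / 40) (powScale (1 / 2) β * btLog β))) β) *
          levelValue su2Rep 1 ((L : ℝ) ^ 3 * β) 0) * tubeNormSq (softWeight (recordChi L s 43 M β)) v)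
    (hOD : ∀ᶠ β in atTop, ∀ (φ : GaugeConfig 3 1 SU2 → ℝ) (v : GaugeConfig 3 L SU2 → ℝ), Measurable φ → (∃ C : ℝ, ∀ u, |φ u| ≤ C) →
      (∀ u, φ u ≠ 0 → orbitDist u < recordDelta1 L s β) → Measurable v → (∃ C : ℝ, ∀ U, |v U| ≤ C) → (∀ U, v U ≠ 0 → recordChi L s 43 M β U ≠ 0) →
      (∀ u, fibreInner L (softWeight (recordChi L s 43 M β)) (frozenProfile L q (fun β => min (1 / 40) (powScale (1 / 2) β * btLog β)) β) v u = 0) →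
      |tubeCross β (boFun L φ (frozenProfile L q (fun β => min (1 / 40) (powScale (1 / 2) β * btLog β)) β)) v| ≤
          b β * ((btC L β (frozenProfile L q (fun β => min (1 / 40) (powScale (1 / 2) β * btLog β)) β) (btEps β) (5 * (powScale (1 / 2) β * btLog β ^ 2)) /
              fpZ (btEps β) / recordGamma L (frozenProfile L q (fun β => min (1 / 40) (powScale (1 / 2) β * btLog β))) β) *
            levelValue su2Rep 1 ((L : ℝ) ^ 3 * β) 0) *
          Real.sqrt (tubeNormSq (softWeight (recordChi L s 43 M β)) (boFun L φ (frozenProfile L q (fun β => min (1 / 40) (powScale (1 / 2) β * btLog β)) β))) *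
          Real.sqrt (tubeNormSq (softWeight (recordChi L s 43 M β)) v) ∧
      |tubeCross β v (boFun L φ (frozenProfile L q (fun β => min (1 / 40) (powScale (1 / 2) β * btLog β)) β))| ≤
          b β * ((btC L β (frozenProfile L q (fun β => min (1 / 40) (powScale (1 / 2) β * btLog β)) β) (btEps β) (5 * (powScale (1 / 2) β * btLog β ^ 2)) /
              fpZ (btEps β) / recordGamma L (frozenProfile L q (fun β => min (1 / 40) (powScale (1 / 2) β * btLog β))) β) *
            levelValue su2Rep 1 ((L : ℝ) ^ 3 * β) 0) *
          Real.sqrt (tubeNormSq (softWeight (recordChi L s 43 M β)) (boFun L φ (frozenProfile L q (fun β => min (1 / 40) (powScale (1 / 2) β * btLog β)) β))) *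
          Real.sqrt (tubeNormSq (softWeight (recordChi L s 43 M β)) v)) :
    Nonempty (RecordAnalyticInput L s M) := by
  set rB : ℝ → ℝ := fun β => min (1 / 40) (powScale (1 / 2) β * btLog β) with hrBdef
  have hr0 : ∀ β, 0 < rB β := fun β => lt_min (by norm_num) (mul_pos (powScale_pos _ _) (lt_of_lt_of_le one_pos (one_le_btLog β)))
  obtain ⟨hΩm, hΩ1, hΩinv, hΩr, hγ⟩ := frozenProfile_fields (L := L) (q := q) (r := rB) hq hq0 hqinv hr0
  have hΩ0 : ∀ β x, 0 ≤ frozenProfile L q rB β x := fun β x => (frozenProfile_mem_Icc (L := L) (q := q) hq0 rB β x).1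
  have hI : ∀ β, 0 < ∫ v, frozenProfile L q rB β (linkEmbed L v) ∂orthoTransverse L := fun β =>
    integral_profile_pos (hΩm β) (hΩ1 β) (hΩ0 β) (hr0 β) fun x hx => frozenProfile_ne_zero_of_norm_lt (L := L) q rB β hx
  exact recordAnalyticInput_of_profile hs6 hs4 hΩm hΩ1 hΩ0 hΩinv hΩr hI hγ hb hb_small hθ₀ hST hOD

/-- ★★ **C4-CORE(s) FROM (B-ST) + (B-OD) FOR A FROZEN PROFILE** (`1/6 < s < 1/5`, `L` with a nonzero site): for `M ≥ M₀(L)`, the two analytic bricks against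
`Ω = frozenProfile L q r_B` (`r_B = min(1/40, β^{-1/2}ℓ)`, any colour-blind measurable `q ≥ 0`) give `InnerNoIntruderOneOrbitAt L β^{-s}`. [cite: Luscher1983, §3] -/
theorem innerNoIntruderOneOrbitAt_of_frozenProfile (hL : Nonempty (NzSite L)) {s : ℝ} (hs6 : 1 / 6 < s) (hs5 : s < 1 / 5) {q : ℝ → LinkSpace L → ℝ}
    (hq : ∀ β, Measurable (q β)) (hq0 : ∀ β x, 0 ≤ q β x) (hqinv : ∀ β (g : SU2) (x : LinkSpace L), q β (adL L g x) = q β x) :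
    ∃ M₀ : ℝ, 2 ≤ M₀ ∧ ∀ M : ℝ, M₀ ≤ M → ∀ (b : ℝ → ℝ) (θ₀ : ℝ), (∀ β, 0 ≤ b β) →
      (∀ a : ℝ, 0 < a → ∀ᶠ β in atTop, b β ^ 2 ≤ a * bareLambda ((L : ℝ) ^ 3 * β)) → (0 < θ₀ ∧ θ₀ ≤ 1) →
      (∀ᶠ β in atTop, ∀ v : GaugeConfig 3 L SU2 → ℝ, Measurable v → (∃ C : ℝ, ∀ U, |v U| ≤ C) → (∀ U, v U ≠ 0 → recordChi L s 43 M β U ≠ 0) →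
        (∀ u, fibreInner L (softWeight (recordChi L s 43 M β)) (frozenProfile L q (fun β => min (1 / 40) (powScale (1 / 2) β * btLog β)) β) v u = 0) →
        tubeForm β v ≤ (1 - θ₀) *
          ((btC L β (frozenProfile L q (fun β => min (1 / 40) (powScale (1 / 2) β * btLog β)) β) (btEps β) (5 * (powScale (1 / 2) β * btLog β ^ 2)) / fpZ (btEps β) /
              recordGamma L (frozenProfile L q (fun β => min (1 / 40) (powScale (1 / 2) β * btLog β))) β) *
            levelValue su2Rep 1 ((L : ℝ) ^ 3 * β) 0) * tubeNormSq (softWeight (recordChi L s 43 M β)) v) →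
      (∀ᶠ β in atTop, ∀ (φ : GaugeConfig 3 1 SU2 → ℝ) (v : GaugeConfig 3 L SU2 → ℝ), Measurable φ → (∃ C : ℝ, ∀ u, |φ u| ≤ C) →
        (∀ u, φ u ≠ 0 → orbitDist u < recordDelta1 L s β) → Measurable v → (∃ C : ℝ, ∀ U, |v U| ≤ C) → (∀ U, v U ≠ 0 → recordChi L s 43 M β U ≠ 0) →
        (∀ u, fibreInner L (softWeight (recordChi L s 43 M β)) (frozenProfile L q (fun β => min (1 / 40) (powScale (1 / 2) β * btLog β)) β) v u = 0) →
        |tubeCross β (boFun L φ (frozenProfile L q (fun β => min (1 / 40) (powScale (1 / 2) β * btLog β)) β)) v| ≤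
            b β * ((btC L β (frozenProfile L q (fun β => min (1 / 40) (powScale (1 / 2) β * btLog β)) β) (btEps β) (5 * (powScale (1 / 2) β * btLog β ^ 2)) /
                fpZ (btEps β) / recordGamma L (frozenProfile L q (fun β => min (1 / 40) (powScale (1 / 2) β * btLog β))) β) *
              levelValue su2Rep 1 ((L : ℝ) ^ 3 * β) 0) *
            Real.sqrt (tubeNormSq (softWeight (recordChi L s 43 M β)) (boFun L φ (frozenProfile L q (fun β => min (1 / 40) (powScale (1 / 2) β * btLog β)) β))) *
            Real.sqrt (tubeNormSq (softWeight (recordChi L s 43 M β)) v) ∧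
        |tubeCross β v (boFun L φ (frozenProfile L q (fun β => min (1 / 40) (powScale (1 / 2) β * btLog β)) β))| ≤
            b β * ((btC L β (frozenProfile L q (fun β => min (1 / 40) (powScale (1 / 2) β * btLog β)) β) (btEps β) (5 * (powScale (1 / 2) β * btLog β ^ 2)) /
                fpZ (btEps β) / recordGamma L (frozenProfile L q (fun β => min (1 / 40) (powScale (1 / 2) β * btLog β))) β) *
              levelValue su2Rep 1 ((L : ℝ) ^ 3 * β) 0) *
            Real.sqrt (tubeNormSq (softWeight (recordChi L s 43 M β)) (boFun L φ (frozenProfile L q (fun β => min (1 / 40) (powScale (1 / 2) β * btLog β)) β))) *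
            Real.sqrt (tubeNormSq (softWeight (recordChi L s 43 M β)) v)) →
      InnerNoIntruderOneOrbitAt L (powScale s) := by
  obtain ⟨M₀, hM₀, h⟩ := innerNoIntruderOneOrbitAt_of_analyticInput (L := L) hL (by linarith) hs5
  refine ⟨M₀, hM₀, fun M hM b θ₀ hb hbs hθ hST hOD => ?_⟩
  obtain ⟨A⟩ := recordAnalyticInput_of_frozenProfile (M := M) hs6 (by linarith) hq hq0 hqinv hb hbs hθ hST hOD
  exact h M hM A

end Summit.QuantumFields.YangMills.Theorems.FemtoTransferGap.TwoLattice.ConstTube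

end
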